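import Literature.MathematicalPhysics.QuantumFieldTheory.TomboulisYaffeLoopBounds
import Literature.MathematicalPhysics.QuantumFieldTheory.TomboulisYaffeTwistBound
import HarnessLib

/-!
# The Tomboulis–Yaffe inequalities: Wilson loops and Polyakov-loop correlators are bounded by
# the electric-flux (twist) free energy

E. T. Tomboulis and L. G. Yaffe, Comm. Math. Phys. **100** (1985) 313–341, §II eq. (2.10) and
Appendix I ("Confinement criteria inequalities", eqs. (A1.3)–(A1.9)): on a periodic lattice whose
sides are powers of two, reflection positivity gives the chain
`W_{I,J} ≤ W_{2I,J}^{1/2}` (A1.3), `W_{L_t/2,J} ≤ 2 G_J^{1/2}` (A1.6)–(A1.7), `G_J ≤ G_{2J}^{1/2}` (§B),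
`G_{L_s/2} ≤ 2 exp(-F^{elec}/2T)` (A1.8), hence `G(x) ≤ (4 exp(-F^{elec}/T))^{x/L_s}` (A1.9) = (2.10)
and the Wilson-loop bound by the electric-flux free energy `exp(-F^{elec}/T) = ½(1 - Z⁻/Z)` (2.9).

This file assembles the chain on the torus `(ℤ/Lℤ)^d` with `L = 2^(n+1)`, for Wilson's action with
a compact gauge group `G`, a continuous `N`-dimensional representation `ρ`, any real `β`, and a
central element `z` with `ρ(z) = ω · 1`, `|ω| = 1`, `ω ≠ 1`; throughout
`r = Z(z; (0,j)) / Z(1; (0,j))` (`twistedPartitionFunction`) and `ε = 8(1 - r)/|1 - ω|²`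
(`= 2(1 - r) = 4 · ½(1 - Z⁻/Z)` when `ω = -1`):

* `polyakovCorrelator_norm_le_twist` — (A1.9)/(2.10):
  `|⟨tr ρ(Πⱼ(0)) conj tr ρ(Πⱼ(s e₀))⟩| ≤ N² ε^{s/L}` for `s = 2^k ≤ L/2`;
* `wilsonLoop_abs_le_twist` — the Wilson-loop form:
  `|⟨W_{h×w}⟩| ≤ N^{2h/L} ε^{hw/L²}` for `h = 2^a ≤ L/2`, `w = 2^b ≤ L/2` (normalised trace);
* `plaquette_abs_le_twist` — `h = w = 1`;
* `neg_log_electricFlux_le_plaquette` — for `ρ(z) = -1`, the free-energy form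
  `-ln(½(1 - Z⁻/Z)) ≤ L²(-ln⟨W_{1×1}⟩) + 2L ln N + ln 4`.

The links of the chain are the theorems of `TomboulisYaffeLoopBounds` (doubling of Wilson loops,
passage to Polyakov loops, doubling of the correlator, axis exchange) and `TomboulisYaffeTwistBound`
((A1.8)); here only the downward induction `a_i² ≤ C|a_{i+1}|, |a_n| ≤ C t^{2^n} ⇒ |a_i| ≤ C t^{2^i}`
is added. Scope: the symmetric torus of side `L = 2^(n+1)` in every direction (TY allow
`L_t ≠ L_s`, both powers of two). All statements are proved; there are no definitions.
-- TODO(general form): asymmetric tori `L_t × L_s^{d-1}` need the tree's site reflection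
-- positivity for unequal sides.

## References

* E. T. Tomboulis, L. G. Yaffe, Comm. Math. Phys. 100 (1985) 313–341, §II (2.8)–(2.10), App. I
  (A1.3)–(A1.9). [TomboulisYaffe1985]
* T. G. Kovács, E. T. Tomboulis, Phys. Rev. D 65 (2002) 074501, §2 eq. (2.6); T. Kanazawa,
  Ann. Phys. 324 (2009) 1634, §2 Thm 1–2 (the Wilson-loop form as quoted later). [Kanazawa2008]
-/

open MeasureTheory Finset Complex
open scoped ComplexOrder ComplexConjugate

namespace Literature.MathematicalPhysics.QuantumFieldTheory

noncomputable section

namespace TomboulisYaffe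

open WilsonRP WilsonSiteRP

variable {d L N : ℕ} [NeZero d] [NeZero L] {G : Type*} [Group G] [TopologicalSpace G]
  [IsTopologicalGroup G] [CompactSpace G] [MeasurableSpace G] [BorelSpace G]
  (ρ : G →* Matrix (Fin N) (Fin N) ℂ)

/-! ## The assembled Tomboulis–Yaffe inequalities on the torus of side `L = 2^(n+1)` -/

section Assembly

/-- Downward induction along a doubling chain: if `a_i² ≤ C |a_{i+1}|` for `i < n` and
`|a_n| ≤ C t^{2^n}` then `|a_i| ≤ C t^{2^i}` for every `i ≤ n` (the iteration behind TY
(A1.3)–(A1.4), (A1.7) and (A1.9): "repeated application … then yields"). [folklore] -/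
private theorem chain_le {a : ℕ → ℝ} {C t : ℝ} (hC : 0 ≤ C) (ht : 0 ≤ t) {n : ℕ}
    (hstep : ∀ i < n, a i ^ 2 ≤ C * |a (i + 1)|) (hlast : |a n| ≤ C * t ^ 2 ^ n) :
    ∀ i ≤ n, |a i| ≤ C * t ^ 2 ^ i := by
  suffices h : ∀ k i, i + k = n → |a i| ≤ C * t ^ 2 ^ i from
    fun i hi => h (n - i) i (by omega)
  intro k
  induction k with
  | zero => intro i hi; rw [add_zero] at hi; subst hi; exact hlast
  | succ k ih =>
    intro i hi
    have h1 := ih (i + 1) (by omega)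
    refine abs_le_of_sq_le_sq ?_ (mul_nonneg hC (pow_nonneg ht _))
    calc a i ^ 2 ≤ C * |a (i + 1)| := hstep i (by omega)
      _ ≤ C * (C * t ^ 2 ^ (i + 1)) := mul_le_mul_of_nonneg_left h1 hC
      _ = (C * t ^ 2 ^ i) ^ 2 := by rw [pow_succ, pow_mul]; ring

/-- **Tomboulis–Yaffe (A1.9) / (2.10): the Polyakov-loop correlator is bounded by a power of the
electric-flux free energy.** Torus `(ℤ/Lℤ)^d` with `L = 2^(n+1)`, compact `G`, continuous
`N`-dimensional `ρ`, any real `β`, a spatial direction `j`, a central `z` with `ρ(z) = ω · 1`,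
`|ω| = 1`, `ω ≠ 1`; `r = Z(z; (0,j))/Z(1; (0,j))` the twist ratio and `ε = 8(1 - r)/|1 - ω|²`. Then
for every separation `s = 2^k ≤ L/2`,
`|⟨tr ρ(Πⱼ(0)) · conj tr ρ(Πⱼ(s e₀))⟩| ≤ N² ε^{s/L}`.
For `SU(2)` (`N = 2`, `ω = -1`, `ε = 2(1 - r) = 4 exp(-F^{elec}/T)`) and normalised traces this is the
printed `G(x) = exp(-F_{qq̄}(x)/T) ≤ (4 exp(-F^{elec}/T))^{x/L_s}`, i.e. (2.10)
`F_{qq̄}(|x - x'|) ≥ |x - x'| (F^{elec} - 2T ln 2)/L_s` for `|x - x'| ≤ L_s/2` (TY state it for all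
such separations on lattices whose sides are powers of two; proved here along the doubling chain
`s = 2^k`, which is what the reflection-positivity iteration gives). Proof as printed: (A1.8) at
`s = L/2` (`polyakovCorrelator_half_normSq_le_twist`) and the Schwarz doubling step
`G(s)² ≤ G(2s)` (`polyakovCorrelator_normSq_le_double`) iterated downwards.
[cite: TomboulisYaffe1985, §II eq. (2.10) and App. I §C eq. (A1.9)] -/
theorem polyakovCorrelator_norm_le_twist (n : ℕ) (hL : L = 2 ^ (n + 1)) (hρ : Continuous ρ)
    (β : ℝ) {j : Fin d} (hj : (0 : Fin d) < j) {z : G} (hz : z ∈ Subgroup.center G) {ω : ℂ}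
    (hω : ρ z = ω • (1 : Matrix (Fin N) (Fin N) ℂ)) (hω1 : ‖ω‖ = 1) (hne : ω ≠ 1)
    (k : ℕ) (hk : k ≤ n) :
    ‖wilsonExpectation ρ β fun U : GaugeConfig d L G =>
        (ρ (lineHolonomy U j L 0)).trace *
          conj ((ρ (lineHolonomy U j L ((0 : Site d L) + Pi.single 0 ((2 ^ k : ℕ) : ZMod L)))).trace)‖ ≤
      (N : ℝ) ^ 2 * (8 * (1 - twistedPartitionFunction ρ β L z ⟨(0, j), hj⟩ /
        twistedPartitionFunction ρ β L 1 ⟨(0, j), hj⟩) / ‖1 - ω‖ ^ 2) ^ (((2 ^ k : ℕ) : ℝ) / L) := by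
  have hLe : Even L := ⟨2 ^ n, by rw [hL, pow_succ]; ring⟩
  have hL2 : L / 2 = 2 ^ n := by rw [hL, pow_succ, Nat.mul_div_cancel _ two_pos]
  have hL0 : (L : ℝ) ≠ 0 := Nat.cast_ne_zero.2 (NeZero.ne L)
  have hj0 : j ≠ 0 := fun h => (lt_irrefl (0 : Fin d)) (h ▸ hj)
  set r : ℝ := twistedPartitionFunction ρ β L z ⟨(0, j), hj⟩ /
    twistedPartitionFunction ρ β L 1 ⟨(0, j), hj⟩ with hr
  have hr1 : r ≤ 1 := (div_le_one (twistedPartitionFunction_pos ρ hρ β 1 _)).2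
    (twistedPartitionFunction_le_untwisted_plane ρ β hLe hρ hz _)
  have hω2 : 0 < ‖1 - ω‖ ^ 2 := by
    have : 1 - ω ≠ 0 := sub_ne_zero.2 (Ne.symm hne)
    positivity
  set ε : ℝ := 8 * (1 - r) / ‖1 - ω‖ ^ 2 with hε
  have hε0 : 0 ≤ ε := div_nonneg (by linarith) hω2.le
  have hN0 : (0 : ℝ) ≤ (N : ℝ) ^ 2 := sq_nonneg _
  have key := chain_le (a := fun i => ‖wilsonExpectation ρ β fun U : GaugeConfig d L G =>
      (ρ (lineHolonomy U j L 0)).trace *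
        conj ((ρ (lineHolonomy U j L ((0 : Site d L) + Pi.single 0 ((2 ^ i : ℕ) : ZMod L)))).trace)‖)
    (n := n) hN0 (Real.rpow_nonneg hε0 ((1 : ℝ) / L)) ?_ ?_ k hk
  · rw [abs_norm] at key
    refine key.trans (le_of_eq ?_)
    rw [← Real.rpow_mul_natCast hε0]
    congr 2
    push_cast
    field_simp
  · intro i hi
    have hi' : 2 ^ i ≤ L / 2 := by
      rw [hL2]; exact Nat.pow_le_pow_right two_pos (by omega)
    have h := (polyakovCorrelator_normSq_le_double ρ hLe hρ β hj0 (2 ^ i) hi').2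
    rw [show 2 * 2 ^ i = 2 ^ (i + 1) by ring] at h
    rw [abs_norm]
    exact h.trans (mul_le_mul_of_nonneg_left (Complex.re_le_norm _) hN0)
  · have h := polyakovCorrelator_half_normSq_le_twist ρ hLe hρ β hj hz hω hω1
    rw [hL2] at h
    set X : ℂ := wilsonExpectation ρ β fun U : GaugeConfig d L G =>
      (ρ (lineHolonomy U j L 0)).trace *
        conj ((ρ (lineHolonomy U j L ((0 : Site d L) + Pi.single 0 ((2 ^ n : ℕ) : ZMod L)))).trace)
      with hX
    have hpow : (ε ^ ((1 : ℝ) / L)) ^ 2 ^ n = Real.sqrt ε := by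
      rw [← Real.rpow_mul_natCast hε0, Real.sqrt_eq_rpow]
      congr 1
      rw [hL]
      push_cast
      field_simp
      ring
    refine abs_le_of_sq_le_sq ?_ (mul_nonneg hN0 (pow_nonneg (Real.rpow_nonneg hε0 _) _))
    calc ‖X‖ ^ 2 = ‖1 - ω‖ ^ 2 * ‖X‖ ^ 2 / ‖1 - ω‖ ^ 2 := (mul_div_cancel_left₀ _ hω2.ne').symm
      _ ≤ 8 * (N : ℝ) ^ 4 * (1 - r) / ‖1 - ω‖ ^ 2 := div_le_div_of_nonneg_right h hω2.le
      _ = ((N : ℝ) ^ 2 * (ε ^ ((1 : ℝ) / L)) ^ 2 ^ n) ^ 2 := by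
        rw [hpow, mul_pow, Real.sq_sqrt hε0, hε]
        ring

/-- **Tomboulis–Yaffe, Wilson-loop form: Wilson loops are bounded by the electric-flux free
energy.** Same setting (`L = 2^(n+1)`, `ε = 8(1 - r)/|1 - ω|²`, `r = Z(z; (0,j))/Z(1; (0,j))`). For
the rectangular Wilson loop with `h = 2^a ≤ L/2` links in the time direction `0` and `w = 2^b ≤ L/2`
links in the spatial direction `j` (normalised trace, `wilsonLoop`):
`|⟨W_{h×w}⟩| ≤ N^{2h/L} · ε^{hw/L²}`.
This is the chain of Appendix I as printed: (A1.3)–(A1.4) (`W_{I,J}² ≤ W_{2I,J}`, iterated: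
`wilsonLoop_sq_le_double`), (A1.6)–(A1.7) (`W_{L_t/2,J}² ≤` Polyakov-loop correlator:
`wilsonLoop_half_sq_le_polyakovCorrelator`, `polyakovCorrelator_swap`), then (A1.9) and (A1.8)
(`polyakovCorrelator_norm_le_twist`); the factor `N^{2h/L}` is the torus form of TY's "factors of
two [replaced] by the dimension of the fundamental representation". (The Wilson-loop corollary
`W(C) ≤ const · (exp(-F_el/T))^{A/(L_μL_ν)}` is how Kovács–Tomboulis (2002) eq. (2.6) and Kanazawa
(2009) Thm 1–2 quote TY.) [cite: TomboulisYaffe1985, App. I eqs. (A1.3)–(A1.9)] -/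
theorem wilsonLoop_abs_le_twist (n : ℕ) (hL : L = 2 ^ (n + 1)) (hρ : Continuous ρ) (β : ℝ)
    {j : Fin d} (hj : (0 : Fin d) < j) {z : G} (hz : z ∈ Subgroup.center G) {ω : ℂ}
    (hω : ρ z = ω • (1 : Matrix (Fin N) (Fin N) ℂ)) (hω1 : ‖ω‖ = 1) (hne : ω ≠ 1)
    (a b : ℕ) (ha : a ≤ n) (hb : b ≤ n) :
    |wilsonExpectation ρ β (wilsonLoop ρ (0 : Site d L) 0 j (2 ^ a) (2 ^ b))| ≤
      (N : ℝ) ^ (((2 * 2 ^ a : ℕ) : ℝ) / L) *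
        (8 * (1 - twistedPartitionFunction ρ β L z ⟨(0, j), hj⟩ /
          twistedPartitionFunction ρ β L 1 ⟨(0, j), hj⟩) / ‖1 - ω‖ ^ 2) ^
            (((2 ^ a * 2 ^ b : ℕ) : ℝ) / (L : ℝ) ^ 2) := by
  have hLe : Even L := ⟨2 ^ n, by rw [hL, pow_succ]; ring⟩
  have hL2 : L / 2 = 2 ^ n := by rw [hL, pow_succ, Nat.mul_div_cancel _ two_pos]
  have hL0 : (L : ℝ) ≠ 0 := Nat.cast_ne_zero.2 (NeZero.ne L)
  have hj0 : j ≠ 0 := fun h => (lt_irrefl (0 : Fin d)) (h ▸ hj)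
  set r : ℝ := twistedPartitionFunction ρ β L z ⟨(0, j), hj⟩ /
    twistedPartitionFunction ρ β L 1 ⟨(0, j), hj⟩ with hr
  have hr1 : r ≤ 1 := (div_le_one (twistedPartitionFunction_pos ρ hρ β 1 _)).2
    (twistedPartitionFunction_le_untwisted_plane ρ β hLe hρ hz _)
  have hω2 : 0 < ‖1 - ω‖ ^ 2 := by
    have : 1 - ω ≠ 0 := sub_ne_zero.2 (Ne.symm hne)
    positivity
  set ε : ℝ := 8 * (1 - r) / ‖1 - ω‖ ^ 2 with hε
  have hε0 : 0 ≤ ε := div_nonneg (by linarith) hω2.le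
  have hN0 : (0 : ℝ) ≤ (N : ℝ) := Nat.cast_nonneg _
  -- the base of the chain in the time extent: `t = N^{2/L} ε^{w/L²}`
  have ht0 : (0 : ℝ) ≤ (N : ℝ) ^ ((2 : ℝ) / L) * ε ^ (((2 ^ b : ℕ) : ℝ) / (L : ℝ) ^ 2) :=
    mul_nonneg (Real.rpow_nonneg hN0 _) (Real.rpow_nonneg hε0 _)
  have key := chain_le
    (a := fun i => wilsonExpectation ρ β (wilsonLoop ρ (0 : Site d L) 0 j (2 ^ i) (2 ^ b)))
    (n := n) zero_le_one ht0 ?_ ?_ a ha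
  · rw [one_mul] at key
    refine key.trans (le_of_eq ?_)
    rw [mul_pow, ← Real.rpow_mul_natCast hN0, ← Real.rpow_mul_natCast hε0]
    congr 2
    · push_cast; ring
    · push_cast; ring
  · intro i hi
    have hi' : 2 ^ i ≤ L / 2 := by
      rw [hL2]; exact Nat.pow_le_pow_right two_pos (by omega)
    have h := (wilsonLoop_sq_le_double ρ hLe hρ β hj0 (2 ^ i) (2 ^ b) hi').2
    rw [show 2 * 2 ^ i = 2 ^ (i + 1) by ring] at h
    rw [one_mul]
    exact h.trans (le_abs_self _)
  · rw [one_mul]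
    have h1 := wilsonLoop_half_sq_le_polyakovCorrelator ρ hLe hρ β hj0 (2 ^ b)
    rw [hL2, polyakovCorrelator_swap ρ hρ β j (2 ^ b)] at h1
    have h2 := polyakovCorrelator_norm_le_twist ρ n hL hρ β hj hz hω hω1 hne b hb
    rw [← hr, ← hε] at h2
    refine abs_le_of_sq_le_sq ?_ (pow_nonneg ht0 _)
    calc (wilsonExpectation ρ β (wilsonLoop ρ (0 : Site d L) 0 j (2 ^ n) (2 ^ b))) ^ 2
        ≤ _ := h1
      _ ≤ _ := Complex.re_le_norm _
      _ ≤ (N : ℝ) ^ 2 * ε ^ (((2 ^ b : ℕ) : ℝ) / L) := by exact_mod_cast h2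
      _ = (((N : ℝ) ^ ((2 : ℝ) / L) * ε ^ (((2 ^ b : ℕ) : ℝ) / (L : ℝ) ^ 2)) ^ 2 ^ n) ^ 2 := by
        rw [← pow_mul, show 2 ^ n * 2 = L by rw [hL, pow_succ], mul_pow,
          ← Real.rpow_mul_natCast hN0, ← Real.rpow_mul_natCast hε0, ← Real.rpow_two]
        congr 2
        · field_simp
        · push_cast; field_simp

/-- **The plaquette and the electric flux** (the case `h = w = 1` of `wilsonLoop_abs_le_twist`; TY
(A1.4) with `I = J = L/2` combined with (A1.7)–(A1.9)): on the torus of side `L = 2^(n+1)`,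
`|⟨W_{1×1}⟩| ≤ N^{2/L} · ε^{1/L²}` with `ε = 8(1 - Z(z)/Z(1))/|1 - ω|²`; equivalently the
electric-flux free energy is bounded by `L²` times the plaquette "string tension" up to the printed
constants. [cite: TomboulisYaffe1985, App. I eqs. (A1.4), (A1.7)–(A1.9)] -/
theorem plaquette_abs_le_twist (n : ℕ) (hL : L = 2 ^ (n + 1)) (hρ : Continuous ρ) (β : ℝ)
    {j : Fin d} (hj : (0 : Fin d) < j) {z : G} (hz : z ∈ Subgroup.center G) {ω : ℂ}
    (hω : ρ z = ω • (1 : Matrix (Fin N) (Fin N) ℂ)) (hω1 : ‖ω‖ = 1) (hne : ω ≠ 1) :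
    |wilsonExpectation ρ β (wilsonLoop ρ (0 : Site d L) 0 j 1 1)| ≤
      (N : ℝ) ^ ((2 : ℝ) / L) *
        (8 * (1 - twistedPartitionFunction ρ β L z ⟨(0, j), hj⟩ /
          twistedPartitionFunction ρ β L 1 ⟨(0, j), hj⟩) / ‖1 - ω‖ ^ 2) ^ ((1 : ℝ) / (L : ℝ) ^ 2) := by
  have h := wilsonLoop_abs_le_twist ρ n hL hρ β hj hz hω hω1 hne 0 0 (Nat.zero_le _) (Nat.zero_le _)
  simpa only [pow_zero, mul_one, Nat.cast_ofNat, Nat.cast_one] using h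

/-- **The printed confinement criterion, `SU(2)`-type centre (`ρ(z) = -1`)**: TY's (2.9)
`exp(-F_el/T) = ½(1 - Z⁻/Z)`, so with `ε = 2(1 - r) = 4 · ½(1 - r)` the plaquette bound reads, in
free-energy form, `-ln(½(1 - Z⁻/Z)) ≤ L² (-ln⟨W_{1×1}⟩) + 2L ln N + ln 4` whenever the plaquette
expectation is positive: a finite-volume lattice with a small plaquette "string tension" cannot have a
small electric-flux free energy (TY §II: "if the vortex free energy vanishes exponentially fast …
then static quarks are confined"). [cite: TomboulisYaffe1985, §II eqs. (2.9)–(2.10), App. I] -/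
theorem neg_log_electricFlux_le_plaquette (n : ℕ) (hL : L = 2 ^ (n + 1)) (hρ : Continuous ρ) (β : ℝ)
    {j : Fin d} (hj : (0 : Fin d) < j) {z : G} (hz : z ∈ Subgroup.center G)
    (hω : ρ z = -(1 : Matrix (Fin N) (Fin N) ℂ))
    (hW : 0 < wilsonExpectation ρ β (wilsonLoop ρ (0 : Site d L) 0 j 1 1)) :
    -Real.log ((1 - twistedPartitionFunction ρ β L z ⟨(0, j), hj⟩ /
        twistedPartitionFunction ρ β L 1 ⟨(0, j), hj⟩) / 2) ≤
      (L : ℝ) ^ 2 * (-Real.log (wilsonExpectation ρ β (wilsonLoop ρ (0 : Site d L) 0 j 1 1))) +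
        2 * L * Real.log N + Real.log 4 := by
  have hLe : Even L := ⟨2 ^ n, by rw [hL, pow_succ]; ring⟩
  have hL0 : (L : ℝ) ≠ 0 := Nat.cast_ne_zero.2 (NeZero.ne L)
  have h := plaquette_abs_le_twist ρ n hL hρ β hj hz (ω := -1) (by rw [hω, neg_smul, one_smul])
    (by simp) (by norm_num)
  have h4 : ‖(1 : ℂ) - -1‖ ^ 2 = 4 := by
    rw [sub_neg_eq_add, one_add_one_eq_two, Complex.norm_two]; norm_num
  rw [h4, abs_of_pos hW] at h
  set W : ℝ := wilsonExpectation ρ β (wilsonLoop ρ (0 : Site d L) 0 j 1 1) with hWdef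
  set r : ℝ := twistedPartitionFunction ρ β L z ⟨(0, j), hj⟩ /
    twistedPartitionFunction ρ β L 1 ⟨(0, j), hj⟩ with hr
  have hr1 : r ≤ 1 := (div_le_one (twistedPartitionFunction_pos ρ hρ β 1 _)).2
    (twistedPartitionFunction_le_untwisted_plane ρ β hLe hρ hz _)
  have hε : 8 * (1 - r) / 4 = 4 * ((1 - r) / 2) := by ring
  rw [hε] at h
  rcases (show (0 : ℝ) ≤ (1 - r) / 2 by linarith).eq_or_lt with h0 | hpos
  · exfalso
    rw [← h0, mul_zero, Real.zero_rpow (by positivity), mul_zero] at h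
    exact absurd h (not_le.2 hW)
  have hN : (0 : ℝ) < N := by
    rcases Nat.eq_zero_or_pos N with hN | hN
    · exfalso
      subst hN
      have : W = 0 := by
        rw [hWdef]
        unfold wilsonExpectation wilsonLoop
        simp
      exact absurd this hW.ne'
    · exact_mod_cast hN
  have hq : (0 : ℝ) < 4 * ((1 - r) / 2) := by positivity
  have hlog := Real.log_le_log hW h
  rw [Real.log_mul (Real.rpow_pos_of_pos hN _).ne' (Real.rpow_pos_of_pos hq _).ne',
    Real.log_rpow hN, Real.log_rpow hq, Real.log_mul four_ne_zero hpos.ne'] at hlog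
  have hL2pos : (0 : ℝ) < (L : ℝ) ^ 2 := by positivity
  have hmul := mul_le_mul_of_nonneg_left hlog hL2pos.le
  have expand : (L : ℝ) ^ 2 * ((2 : ℝ) / L * Real.log N +
      (1 : ℝ) / (L : ℝ) ^ 2 * (Real.log 4 + Real.log ((1 - r) / 2))) =
      2 * L * Real.log N + Real.log 4 + Real.log ((1 - r) / 2) := by
    field_simp
    ring
  rw [expand] at hmul
  linarith

end Assembly

end TomboulisYaffe

end

end Literature.MathematicalPhysics.QuantumFieldTheory
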